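import Mathlib
import Literature.Computability.AlgebraicComplexity.StandardFamilies
import Literature.Computability.AlgebraicComplexity.AlperBogartVelascoIsotropy
import Literature.LinearAlgebra.Matrix.PermanentSubperm

/-!
# No 7-plane in the permanental cubic `V(per₃)`

Route `ValiantsHypothesis/BorderApolarity`, crux `ToricWitnessObstructionQP`
(stmt-ValiantsHypothesis-14753), line `Sketch`, lead c5 — helper for the regime analysis of torus
leading forms of `per₃` below Grenet's size `7` (crux work note `regimes.md`, §5): the two places
where the smallest open instances `(3,5)`, `(3,6)` of the registered stub `stub_equivariantCore` meet
an ideal generated by TWO linear forms (the corank-`2` branch of the jet regime, and the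
`(4,5)`-compression spaces of the top-degree regime) are closed by the following elementary fact.

* `finrank_le_six_of_eval_perPoly_three_eq_zero`: over a field with `2 ≠ 0`, a linear subspace of
  `K^{3 × 3}` on which the `3 × 3` permanent vanishes identically has dimension `≤ 6`
  (sharp: a zero row).  Equivalently (`eval_perPoly_three_ne_zero_of_two_forms`) `per₃` does not lie
  in any ideal generated by two linear forms.

Proof.  If the row-`0` projection of `W` is onto, the `t²`-coefficients of `per(y + tz)`,
`y ∈ W`, `z ∈ N := W ∩ {row 0 = 0}`, show that the three `2 × 2` permanents of rows `1, 2` vanish on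
`N`; polarising, `N` maps isotropically into the split quadric on `K² × K²`
(`AlperBogartVelasco.finrank_le_card_of_isotropic`), so `dim N ≥ 4` forces every coordinate vector
of rows `1, 2` into `N`, which contradicts the vanishing.  If no row projection is onto, three
rank–nullity steps give `dim W ≤ 2 + 2 + 2`.  (No auxiliary definitions: the row projections are
the explicit maps `LinearMap.pi fun j => LinearMap.proj (i, j)`.)
-/

open MvPolynomial Module Matrix

-- the mandated summit-side namespace repeats a component by design (single-problem summit)
set_option linter.dupNamespace false

namespace Summit.ValiantsHypothesis.ValiantsHypothesis.Theorems.BorderApolarityToricWitnessObstructionQP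

noncomputable section

namespace NoSevenPlane

open Literature.Computability.AlgebraicComplexity

variable {K : Type*} [Field K]

/-- The `3 × 3` permanent evaluated at a point, expanded along row `0`. [folklore] -/
theorem eval_perPoly_three (x : Fin 3 × Fin 3 → K) :
    eval x (perPoly (Fin 3) K) =
      x (0, 0) * (x (1, 1) * x (2, 2) + x (1, 2) * x (2, 1)) +
      x (0, 1) * (x (1, 0) * x (2, 2) + x (1, 2) * x (2, 0)) +
      x (0, 2) * (x (1, 0) * x (2, 1) + x (1, 1) * x (2, 0)) := by
  rw [eval_perPoly, Matrix.permanent_fin_three_row]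
  simp only [Matrix.of_apply]

/-- Second difference of `per₃` along a direction `z` with zero row `0`: twice the `t²`-coefficient
of `per(y + tz)`, namely `2 Σ_j y(0,j)·cop_j(z)` with `cop_j` the `2 × 2` permanent of rows `1, 2` on
the columns `j + 1, j + 2`. [folklore] -/
theorem eval_add_add_eval_sub (y z : Fin 3 × Fin 3 → K) (hz : ∀ j, z (0, j) = 0) :
    eval (y + z) (perPoly (Fin 3) K) + eval (y - z) (perPoly (Fin 3) K) -
        2 * eval y (perPoly (Fin 3) K) =
      2 * (y (0, 0) * (z (1, 1) * z (2, 2) + z (1, 2) * z (2, 1)) +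
        y (0, 1) * (z (1, 2) * z (2, 0) + z (1, 0) * z (2, 2)) +
        y (0, 2) * (z (1, 0) * z (2, 1) + z (1, 1) * z (2, 0))) := by
  simp only [eval_perPoly_three, Pi.add_apply, Pi.sub_apply, hz]
  ring

/-- The cyclic `2 × 2` permanents of rows `1, 2`, as the `j`-th coefficient above. [folklore] -/
theorem cop_eq (j : Fin 3) (y z : Fin 3 × Fin 3 → K) (hy : ∀ j', y (0, j') = if j' = j then 1 else 0) :
    y (0, 0) * (z (1, 1) * z (2, 2) + z (1, 2) * z (2, 1)) +
        y (0, 1) * (z (1, 2) * z (2, 0) + z (1, 0) * z (2, 2)) +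
        y (0, 2) * (z (1, 0) * z (2, 1) + z (1, 1) * z (2, 0)) =
      z (1, j + 1) * z (2, j + 2) + z (1, j + 2) * z (2, j + 1) := by
  rw [hy 0, hy 1, hy 2]
  fin_cases j <;> simp

/-- Polarisation of the cyclic `2 × 2` permanent `cop_j`. [folklore] -/
theorem cop_add (j : Fin 3) (z z' : Fin 3 × Fin 3 → K) :
    (z + z') (1, j + 1) * (z + z') (2, j + 2) + (z + z') (1, j + 2) * (z + z') (2, j + 1) -
        (z (1, j + 1) * z (2, j + 2) + z (1, j + 2) * z (2, j + 1)) -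
        (z' (1, j + 1) * z' (2, j + 2) + z' (1, j + 2) * z' (2, j + 1)) =
      z (1, j + 1) * z' (2, j + 2) + z (1, j + 2) * z' (2, j + 1) +
        (z' (1, j + 1) * z (2, j + 2) + z' (1, j + 2) * z (2, j + 1)) := by
  simp only [Pi.add_apply]
  ring

/-- Rank–nullity for a restriction: `dim U = dim f(U) + dim (U ∩ ker f)`. [folklore] -/
theorem finrank_eq_finrank_map_add {V₂ : Type*} [AddCommGroup V₂] [Module K V₂]
    (U : Submodule K (Fin 3 × Fin 3 → K)) (f : (Fin 3 × Fin 3 → K) →ₗ[K] V₂) :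
    finrank K U = finrank K (U.map f) + finrank K (U ⊓ LinearMap.ker f : Submodule K _) := by
  have h := LinearMap.finrank_range_add_finrank_ker (f.domRestrict U)
  rw [LinearMap.range_domRestrict, LinearMap.ker_domRestrict] at h
  have e : (Submodule.comap U.subtype (LinearMap.ker f)) ≃ₗ[K]
      (U ⊓ LinearMap.ker f : Submodule K (Fin 3 × Fin 3 → K)) := by
    have h1 : Submodule.comap U.subtype (LinearMap.ker f) =
        Submodule.comap U.subtype (U ⊓ LinearMap.ker f) := by
      rw [Submodule.comap_inf, Submodule.comap_subtype_self, top_inf_eq]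
    rw [h1]
    exact Submodule.comapSubtypeEquivOfLe inf_le_left
  rw [← e.finrank_eq]
  omega

/-- **Main step (row `0` onto).**  If `per₃` vanishes on `W`, the row-`0` projection of `W` is all
of `K³` and `dim W ≥ 7`, contradiction. [folklore] -/
theorem false_of_rowProj_zero_eq_top (h2 : (2 : K) ≠ 0) (W : Submodule K (Fin 3 × Fin 3 → K))
    (hW : ∀ x ∈ W, eval x (perPoly (Fin 3) K) = 0)
    (htop : W.map (LinearMap.pi fun j => LinearMap.proj ((0 : Fin 3), j) :
      (Fin 3 × Fin 3 → K) →ₗ[K] (Fin 3 → K)) = ⊤)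
    (h7 : 7 ≤ finrank K W) : False := by
  classical
  set ρ : (Fin 3 × Fin 3 → K) →ₗ[K] (Fin 3 → K) := LinearMap.pi fun j => LinearMap.proj ((0 : Fin 3), j)
    with hρ
  have hρapp : ∀ x j, ρ x j = x (0, j) := fun _ _ => rfl
  set N : Submodule K (Fin 3 × Fin 3 → K) := W ⊓ LinearMap.ker ρ with hNdef
  have hNW : N ≤ W := inf_le_left
  have hNrow : ∀ z ∈ N, ∀ j, z (0, j) = 0 := by
    intro z hz j
    have h := (LinearMap.mem_ker.1 (Submodule.mem_inf.1 hz).2)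
    exact congr_fun h j
  -- `dim N ≥ 4`
  have hN4 : 4 ≤ finrank K N := by
    have h := finrank_eq_finrank_map_add W ρ
    have h3 : finrank K (W.map ρ) ≤ 3 := by
      calc finrank K (W.map ρ) ≤ finrank K (Fin 3 → K) := Submodule.finrank_le _
        _ = 3 := by rw [finrank_fintype_fun_eq_card, Fintype.card_fin]
    rw [← hNdef] at h
    omega
  -- the three cyclic `2 × 2` permanents `cop_j` of rows `1, 2` vanish on `N`
  have hcop : ∀ j, ∀ z ∈ N, z (1, j + 1) * z (2, j + 2) + z (1, j + 2) * z (2, j + 1) = 0 := by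
    intro j z hz
    have hy : (Pi.single j 1 : Fin 3 → K) ∈ W.map ρ := by rw [htop]; exact Submodule.mem_top
    obtain ⟨y, hyW, hy⟩ := Submodule.mem_map.1 hy
    have hy0 : ∀ j', y (0, j') = if j' = j then 1 else 0 := fun j' => by
      rw [← hρapp y j', hy, Pi.single_apply]
    have hzW : z ∈ W := hNW hz
    have key := eval_add_add_eval_sub y z (hNrow z hz)
    rw [hW _ (W.add_mem hyW hzW), hW _ (W.sub_mem hyW hzW), hW _ hyW, cop_eq j y z hy0] at key
    have key' : (2 : K) * (z (1, j + 1) * z (2, j + 2) + z (1, j + 2) * z (2, j + 1)) = 0 := by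
      rw [← key]; ring
    exact (mul_eq_zero.1 key').resolve_left h2
  -- coordinate vectors of rows `1, 2` lie in `N`
  have hsingle : ∀ j, (Pi.single ((1 : Fin 3), j) (1 : K) : Fin 3 × Fin 3 → K) ∈ N ∧
      (Pi.single ((2 : Fin 3), j) (1 : K) : Fin 3 × Fin 3 → K) ∈ N := by
    intro j
    -- polarisation map to the split quadric on `K² × K²`
    let c1 : Fin 2 → Fin 3 := ![j + 1, j + 2]
    let c2 : Fin 2 → Fin 3 := ![j + 2, j + 1]
    let φ : (Fin 3 × Fin 3 → K) →ₗ[K] (Fin 2 → K) × (Fin 2 → K) :=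
      (LinearMap.pi fun a : Fin 2 => LinearMap.proj ((1 : Fin 3), c1 a)).prod
        (LinearMap.pi fun a : Fin 2 => LinearMap.proj ((2 : Fin 3), c2 a))
    have hφ1 : ∀ z a, (φ z).1 a = z (1, c1 a) := fun _ _ => rfl
    have hφ2 : ∀ z a, (φ z).2 a = z (2, c2 a) := fun _ _ => rfl
    have hpair : ∀ z z' : Fin 3 × Fin 3 → K, (φ z).1 ⬝ᵥ (φ z').2 + (φ z').1 ⬝ᵥ (φ z).2 =
        z (1, j + 1) * z' (2, j + 2) + z (1, j + 2) * z' (2, j + 1) +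
          (z' (1, j + 1) * z (2, j + 2) + z' (1, j + 2) * z (2, j + 1)) := by
      intro z z'
      simp only [dotProduct, Fin.sum_univ_two, hφ1, hφ2, c1, c2, Matrix.cons_val_zero,
        Matrix.cons_val_one]
    have hφker : ∀ z, φ z = 0 →
        z (1, j + 1) = 0 ∧ z (1, j + 2) = 0 ∧ z (2, j + 2) = 0 ∧ z (2, j + 1) = 0 := by
      intro z h
      have h1 := fun a => congr_fun (congr_arg Prod.fst h) a
      have h2 := fun a => congr_fun (congr_arg Prod.snd h) a
      refine ⟨?_, ?_, ?_, ?_⟩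
      · simpa [hφ1, c1] using h1 0
      · simpa [hφ1, c1] using h1 1
      · simpa [hφ2, c2] using h2 0
      · simpa [hφ2, c2] using h2 1
    -- the image of `N` is isotropic, hence of dimension `≤ 2`
    have hiso : ∀ u ∈ N.map φ, ∀ u' ∈ N.map φ, u.1 ⬝ᵥ u'.2 + u'.1 ⬝ᵥ u.2 = 0 := by
      rintro _ ⟨z, hz, rfl⟩ _ ⟨z', hz', rfl⟩
      rw [hpair, ← cop_add j z z', hcop j _ (N.add_mem hz hz'), hcop j z hz, hcop j z' hz']
      ring
    have hmap : finrank K (N.map φ) ≤ 2 := by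
      have h := AlperBogartVelasco.finrank_le_card_of_isotropic (N.map φ) hiso
      rwa [Fintype.card_fin] at h
    have hker : 2 ≤ finrank K (N ⊓ LinearMap.ker φ : Submodule K _) := by
      have h := finrank_eq_finrank_map_add N φ
      omega
    -- the kernel part lies in the span `D` of the two coordinate vectors of column `j`
    set D : Submodule K (Fin 3 × Fin 3 → K) :=
      Submodule.span K {(Pi.single ((1 : Fin 3), j) (1 : K) : Fin 3 × Fin 3 → K),
        Pi.single ((2 : Fin 3), j) (1 : K)} with hDdef
    have hDle : finrank K D ≤ 2 := by
      refine (finrank_span_le_card _).trans ?_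
      rw [Set.toFinset_card]
      exact (Fintype.card_ofFinset _ _).le.trans (Finset.card_le_two)
    have hle : (N ⊓ LinearMap.ker φ : Submodule K _) ≤ D := by
      intro z hz
      obtain ⟨hzN, hzk⟩ := Submodule.mem_inf.1 hz
      have hz0 := hNrow z hzN
      obtain ⟨hz1, hz2, hz3, hz4⟩ := hφker z (LinearMap.mem_ker.1 hzk)
      have hzeq : z = z (1, j) • (Pi.single ((1 : Fin 3), j) (1 : K) : Fin 3 × Fin 3 → K) +
          z (2, j) • (Pi.single ((2 : Fin 3), j) (1 : K) : Fin 3 × Fin 3 → K) := by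
        funext ⟨a, b⟩
        simp only [Pi.add_apply, Pi.smul_apply, Pi.single_apply, Prod.mk.injEq, smul_eq_mul,
          mul_ite, mul_one, mul_zero]
        obtain h | h | h : b = j ∨ b = j + 1 ∨ b = j + 2 := by
          fin_cases j <;> fin_cases b <;> simp
        · subst h
          fin_cases a <;> simp [hz0]
        · subst h
          fin_cases a <;> simp [hz0, hz1, hz4]
        · subst h
          fin_cases a <;> simp [hz0, hz2, hz3]
      rw [hzeq]
      exact D.add_mem (D.smul_mem _ (Submodule.subset_span (by simp)))
        (D.smul_mem _ (Submodule.subset_span (by simp)))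
    have heq : (N ⊓ LinearMap.ker φ : Submodule K _) = D :=
      Submodule.eq_of_le_of_finrank_le hle (by omega)
    have hDN : D ≤ N := heq ▸ inf_le_left
    exact ⟨hDN (Submodule.subset_span (by simp)), hDN (Submodule.subset_span (by simp))⟩
  -- contradiction: `e₁₁ + e₂₂ ∈ N` but `cop_0 (e₁₁ + e₂₂) = 1`
  have hmem : (Pi.single ((1 : Fin 3), (1 : Fin 3)) (1 : K) : Fin 3 × Fin 3 → K) +
      Pi.single ((2 : Fin 3), (2 : Fin 3)) (1 : K) ∈ N := N.add_mem (hsingle 1).1 (hsingle 2).2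
  have h := hcop 0 _ hmem
  simp at h

/-- Symmetry: the case where the projection to row `i` is onto reduces to row `0` by the row swap
`(0 i)`, which preserves the permanent (`Matrix.permanent_permute_cols`). [folklore] -/
theorem false_of_rowProj_eq_top (h2 : (2 : K) ≠ 0) (W : Submodule K (Fin 3 × Fin 3 → K))
    (hW : ∀ x ∈ W, eval x (perPoly (Fin 3) K) = 0) (i : Fin 3)
    (htop : W.map (LinearMap.pi fun j => LinearMap.proj (i, j) :
      (Fin 3 × Fin 3 → K) →ₗ[K] (Fin 3 → K)) = ⊤)
    (h7 : 7 ≤ finrank K W) : False := by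
  classical
  let σ : Equiv.Perm (Fin 3) := Equiv.swap 0 i
  let e : (Fin 3 × Fin 3 → K) ≃ₗ[K] (Fin 3 × Fin 3 → K) :=
    LinearEquiv.funCongrLeft K K (Equiv.prodCongr σ (Equiv.refl (Fin 3)))
  have he : ∀ (x : Fin 3 × Fin 3 → K) (a b : Fin 3), e x (a, b) = x (σ a, b) := fun x a b => rfl
  let W' : Submodule K (Fin 3 × Fin 3 → K) := W.map (e : (Fin 3 × Fin 3 → K) →ₗ[K] _)
  have hper : ∀ x, eval (e x) (perPoly (Fin 3) K) = eval x (perPoly (Fin 3) K) := by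
    intro x
    rw [eval_perPoly, eval_perPoly]
    have hM : (Matrix.of fun a b : Fin 3 => e x (a, b)) =
        (Matrix.of fun a b : Fin 3 => x (a, b)).submatrix σ id := by
      ext a b
      simp only [Matrix.of_apply, Matrix.submatrix_apply, id_eq, he]
    rw [hM, Matrix.permanent_permute_cols]
  have hW' : ∀ x ∈ W', eval x (perPoly (Fin 3) K) = 0 := by
    rintro _ ⟨x, hx, rfl⟩
    rw [LinearEquiv.coe_coe, hper]
    exact hW x hx
  have htop' : W'.map (LinearMap.pi fun j => LinearMap.proj ((0 : Fin 3), j) :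
      (Fin 3 × Fin 3 → K) →ₗ[K] (Fin 3 → K)) = ⊤ := by
    rw [← Submodule.map_comp]
    have hcomp : (LinearMap.pi fun j => LinearMap.proj ((0 : Fin 3), j) :
        (Fin 3 × Fin 3 → K) →ₗ[K] (Fin 3 → K)).comp (e : (Fin 3 × Fin 3 → K) →ₗ[K] _) =
        (LinearMap.pi fun j => LinearMap.proj (i, j)) := by
      ext x j
      simp [he, σ]
    rw [hcomp, htop]
  have h7' : 7 ≤ finrank K W' := by
    rw [LinearEquiv.finrank_map_eq]
    exact h7
  exact false_of_rowProj_zero_eq_top h2 W' hW' htop' h7'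

/-- If no row projection of `W` is onto then `dim W ≤ 6` (three rank–nullity steps). [folklore] -/
theorem finrank_le_six_of_forall_ne_top (W : Submodule K (Fin 3 × Fin 3 → K))
    (hne : ∀ i : Fin 3, W.map (LinearMap.pi fun j => LinearMap.proj (i, j) :
      (Fin 3 × Fin 3 → K) →ₗ[K] (Fin 3 → K)) ≠ ⊤) : finrank K W ≤ 6 := by
  classical
  let ρ : Fin 3 → (Fin 3 × Fin 3 → K) →ₗ[K] (Fin 3 → K) := fun i =>
    LinearMap.pi fun j => LinearMap.proj (i, j)
  have hρ : ∀ i x j, ρ i x j = x (i, j) := fun _ _ _ => rfl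
  have hlt : ∀ (U : Submodule K (Fin 3 × Fin 3 → K)) (i : Fin 3), U ≤ W →
      finrank K (U.map (ρ i)) ≤ 2 := by
    intro U i hU
    have hle : U.map (ρ i) ≤ W.map (ρ i) := Submodule.map_mono hU
    have hlt : W.map (ρ i) < ⊤ := lt_top_iff_ne_top.2 (hne i)
    have h := Submodule.finrank_lt_finrank_of_lt hlt
    rw [finrank_top, finrank_fintype_fun_eq_card, Fintype.card_fin] at h
    have h' := Submodule.finrank_mono hle
    omega
  set N₁ := (W ⊓ LinearMap.ker (ρ 0) : Submodule K (Fin 3 × Fin 3 → K)) with hN₁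
  set N₂ := (N₁ ⊓ LinearMap.ker (ρ 1) : Submodule K (Fin 3 × Fin 3 → K)) with hN₂
  have e1 := finrank_eq_finrank_map_add W (ρ 0)
  have e2 := finrank_eq_finrank_map_add N₁ (ρ 1)
  have e3 := finrank_eq_finrank_map_add N₂ (ρ 2)
  have hbot : (N₂ ⊓ LinearMap.ker (ρ 2) : Submodule K (Fin 3 × Fin 3 → K)) = ⊥ := by
    rw [eq_bot_iff]
    intro z hz
    obtain ⟨hz2, hk2⟩ := Submodule.mem_inf.1 hz
    obtain ⟨hz1, hk1⟩ := Submodule.mem_inf.1 hz2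
    obtain ⟨_, hk0⟩ := Submodule.mem_inf.1 hz1
    rw [Submodule.mem_bot]
    funext ⟨a, b⟩
    fin_cases a
    · exact (hρ 0 z b).symm.trans (congr_fun (LinearMap.mem_ker.1 hk0) b)
    · exact (hρ 1 z b).symm.trans (congr_fun (LinearMap.mem_ker.1 hk1) b)
    · exact (hρ 2 z b).symm.trans (congr_fun (LinearMap.mem_ker.1 hk2) b)
  rw [hbot, finrank_bot] at e3
  have b1 := hlt W 0 le_rfl
  have b2 := hlt N₁ 1 inf_le_left
  have b3 := hlt N₂ 2 (inf_le_left.trans inf_le_left)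
  rw [← hN₁] at e1
  rw [← hN₂] at e2
  omega

/-- **No 7-plane in `V(per₃)`.**  Over a field with `2 ≠ 0`, a linear subspace of `K^{3×3}` on which
the `3 × 3` permanent vanishes identically has dimension at most `6` (sharp: the matrices with a
zero row). [folklore] -/
theorem finrank_le_six_of_eval_perPoly_three_eq_zero (h2 : (2 : K) ≠ 0)
    (W : Submodule K (Fin 3 × Fin 3 → K)) (hW : ∀ x ∈ W, eval x (perPoly (Fin 3) K) = 0) :
    finrank K W ≤ 6 := by
  by_cases h : ∃ i : Fin 3, W.map (LinearMap.pi fun j => LinearMap.proj (i, j) :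
      (Fin 3 × Fin 3 → K) →ₗ[K] (Fin 3 → K)) = ⊤
  · obtain ⟨i, hi⟩ := h
    by_contra hlt
    exact false_of_rowProj_eq_top h2 W hW i hi (by omega)
  · push Not at h
    exact finrank_le_six_of_forall_ne_top W h

/-- **`per₃` is in no ideal generated by two linear forms**: if `per₃` vanishes wherever two linear
functionals `ℓ₁, ℓ₂` on `K^{3×3}` vanish, contradiction (their common kernel has dimension `≥ 7`).
[folklore] -/
theorem eval_perPoly_three_ne_zero_of_two_forms (h2 : (2 : K) ≠ 0)
    (ℓ₁ ℓ₂ : (Fin 3 × Fin 3 → K) →ₗ[K] K)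
    (h : ∀ x, ℓ₁ x = 0 → ℓ₂ x = 0 → eval x (perPoly (Fin 3) K) = 0) : False := by
  set W : Submodule K (Fin 3 × Fin 3 → K) := LinearMap.ker ℓ₁ ⊓ LinearMap.ker ℓ₂ with hWdef
  have hW : ∀ x ∈ W, eval x (perPoly (Fin 3) K) = 0 := fun x hx =>
    h x (LinearMap.mem_ker.1 (Submodule.mem_inf.1 hx).1) (LinearMap.mem_ker.1 (Submodule.mem_inf.1 hx).2)
  have h6 := finrank_le_six_of_eval_perPoly_three_eq_zero h2 W hW
  -- `dim (ker ℓ₁ ⊓ ker ℓ₂) ≥ 9 - 2`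
  have hk : ∀ ℓ : (Fin 3 × Fin 3 → K) →ₗ[K] K, 8 ≤ finrank K (LinearMap.ker ℓ) := by
    intro ℓ
    have h1 := LinearMap.finrank_range_add_finrank_ker ℓ
    have h2 : finrank K (LinearMap.range ℓ) ≤ 1 := by
      calc finrank K (LinearMap.range ℓ) ≤ finrank K K := Submodule.finrank_le _
        _ = 1 := finrank_self K
    rw [finrank_fintype_fun_eq_card, Fintype.card_prod, Fintype.card_fin] at h1
    omega
  have hsup : finrank K ↥(LinearMap.ker ℓ₁ ⊔ LinearMap.ker ℓ₂) ≤ 9 := by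
    calc finrank K ↥(LinearMap.ker ℓ₁ ⊔ LinearMap.ker ℓ₂) ≤ finrank K (Fin 3 × Fin 3 → K) :=
          Submodule.finrank_le _
      _ = 9 := by rw [finrank_fintype_fun_eq_card, Fintype.card_prod, Fintype.card_fin]
  have hdim := Submodule.finrank_sup_add_finrank_inf_eq (LinearMap.ker ℓ₁) (LinearMap.ker ℓ₂)
  have hk1 := hk ℓ₁
  have hk2 := hk ℓ₂
  rw [← hWdef] at hdim
  omega

end NoSevenPlane

/-- **No 7-plane in `V(per₃)`** (registered helper form of
`NoSevenPlane.finrank_le_six_of_eval_perPoly_three_eq_zero`): over a field with `2 ≠ 0`, every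
linear subspace of `K^{3×3}` on which the `3 × 3` permanent vanishes identically has dimension
`≤ 6`. [folklore] -/
theorem noSevenPlane_perPoly_three : ∀ {K : Type*} [Field K], (2 : K) ≠ 0 → ∀ (W : Submodule K (Fin 3 × Fin 3 → K)), (∀ x ∈ W, MvPolynomial.eval x (Literature.Computability.AlgebraicComplexity.perPoly (Fin 3) K) = 0) → Module.finrank K ↥W ≤ 6 :=
  fun h2 W hW => NoSevenPlane.finrank_le_six_of_eval_perPoly_three_eq_zero h2 W hW

end

end Summit.ValiantsHypothesis.ValiantsHypothesis.Theorems.BorderApolarityToricWitnessObstructionQP
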